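import Summits.BirchSwinnertonDyer.Rank1Residual.X11a.MainConjecture
import HarnessLib

/-!
# Class X2, rank `0`: `BSD(E,p)` at an odd multiplicative EISENSTEIN prime IMPLIES Mazur's main
# conjecture at that prime — the reducible twin of the converse chain; the typed input of sub-cell
# X2b is EXACT (cell `b2b-bsdres`, unit `b2b-bsdres-eisenstein-p2`, gen 3)

HONEST FRAMING (run/shared/lean/b2b/bsd-rank1-residual/, verbatim in every file): the goal of the
cell is to DELETE the COMBINATION-SHAPED residual classes of the Birch–Swinnerton-Dyer formula for
ALL analytic-rank `≤ 1` elliptic curves over `ℚ` — "full BSD formula for every rank `≤ 1` curve in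
class `C`" assembled STRICTLY from published theorems — so that the rank-`≤ 1` remainder becomes
exactly the CONSTRUCTION-SHAPED classes, which are TYPED (missing-input `Prop`s), NOT attempted.
This is not "finishing BSD". Research routes; NO CLAIM BEYOND STATED CLASSES. Theorems only (no
definition, no named fact): every published theorem enters as an explicit hypothesis — the tree's
existing NAMED FACTS — or as a tree theorem. X2b stays CONSTRUCTION-SHAPED.

**Setting.** `E/ℚ` (globally minimal `W`), `ord_{s=1} L(E,s) = 0`, an odd prime `p` of
multiplicative reduction. Sub-cell X2b of class X2 (`X2.CellB W p := r = 0 ∧ ClassX2 W p ∧ ¬GVPar`,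
`X2/Cells.lean`; `ClassX2 W p := p ≠ 2 ∧ Red W p ∧ Mult W p`) has the typed missing input
`X2.MissingInputB W p := X2.MazurMainConjectureAt W p` — Mazur's main conjecture at the pair in the
Néron normalisation with the trivial zero (every datum `(κ, γ, f, ϖ, D)`: `X(E/ℚ_∞)` torsion,
`char_Λ X = (g)`, `ι(T^e·g·w) = ϖ·L_p`, `w ∈ Λˣ`, `e = 1` split / `0` non-split). Gen 1 proved
MC ⇒ `BSD(E,p)` for every rank-`0` pair at an odd multiplicative prime
(`X2.bsdp_of_mazurMainConjectureAt_of_analyticRank_eq_zero`, p199989). This file proves the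
CONVERSE at a reducible `E[p]`, so that on X2's whole rank-`0` half (X2a ∪ X2b, EVERY odd `p`,
`p = 3` included) `BSD(E,p)` ⟺ Mazur's main conjecture at `(E,p)`.

**Core theorem** (`mazurMainConjectureAt_of_divisibilityAt_of_padicValRat_le`, class-agnostic): at
ANY odd multiplicative prime, ONE divisibility at the pair in Kato's shape — `X` torsion and
`ϖ·L_p ∈ ι(T^e · char_Λ X)` for every datum, taken as an INLINE hypothesis `hdiv` (no new `Prop`) —
plus the reverse rank-`0` inequality `ord_p(L(E,1)/Ω_E) ≤ ord_p #Ш + ord_p ∏c_v − 2 ord_p #E(ℚ)_tors`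
give `X2.MazurMainConjectureAt W p`. The argument is Greenberg's (LNM 1716 §4 pp. 112–113, §5),
made integral exactly as in x11a gen 13's surjective file `X11a/MainConjecture.lean` (p201894, whose
proof is followed line by line; its cofactor lemma `X11a.padicValRat_eq_of_torsionSq_mul_eq_cofactor`
is reused): `g = h · f_E ∈ (f_E)` with `ι(T^e g) = ϖ L_p`; `[T^e]`-coefficients (`L_p(0) = 2[0]⁺_f`
non-split, MTT; `[T¹]L_p · log κ(γ) = 𝓛_p[0]⁺_f` split, Greenberg–Stevens) against Jones's leading
term `f_E(0)·(log κ(γ))^e·#tors² = u·(2|𝓛_p)·#Ш[p^∞]·∏c_v` (Stein–Wuthrich 2013 Thm. 6.1, rank `0`,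
`Reg_p = 1`) give `ord_p(L(E,1)/Ω_E) = ord_p h(0) + ord_p #Ш + ord_p ∏c_v − 2 ord_p #tors` with
`ord_p h(0) ≥ 0`; the reverse inequality forces `h(0) ∈ ℤ_p^×`, `h ∈ Λ^×`. NOTHING about `μ` is
used: at an X2b pair `μ(X) ≥ 1` is expected (Greenberg 1999 Prop. 5.7, Greenberg–Vatsal result B),
and the certified main conjecture then has `p ∣ L_p(E)`.

**Instances of `hdiv`** (PUBLISHED named facts of the tree, taken as binders):

| binder | fact (tree decl) | source | status |
|---|---|---|---|
| `hWu` | `Wuthrich2014.thm16_charIdeal_dvd_multiplicative_of_reducible` | Wuthrich, Doc. Math. 19 (2014) Thm. 16 (p. 397): `p > 2`, semistable at `p`, `E[p]` REDUCIBLE ⇒ `char_Λ X ∣ (L_p)`, `I·char_Λ X ∣ (L_p)` at split `p`; torsion: §5 + Greenberg LNM 1716 Thm. 1.5 | PUB, numbered, no flag |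
| (x11a) `hKato` | `Wuthrich2014.kato_charIdeal_dvd_multiplicative_of_surjective` | Kato via Wuthrich Thm. 3 / Cor. 19 (surjective `ρ_{E,p^∞}`) | PUB, flag `Wu14-surj-attribution` — x11a's p201894 is the `p ≥ 5` surjective instance of the core |
| `hJs`/`hJn`, `hHs`/`hHn` | `SteinWuthrich2013.thm61_{split,nonsplit}Multiplicative`, `exists_is{Split,}MultCanonical` | Stein–Wuthrich, Math. Comp. 82 (2013) Thm. 6.1 (Jones 1989), §4.2 | PUB |
| `hGS` | `greenberg_stevens` | Greenberg–Stevens, Invent. Math. 111 (1993); Kobayashi 2006 | PUB |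
| `hGZK`, `hmod`, `hpar` | GZK; modularity | bsd.S17; Wiles, BCDT | PUB |

**Contents** (this file): the core `mazurMainConjectureAt_of_divisibilityAt_of_padicValRat_le`, its
lower-bound form `mazurMainConjectureAt_of_divisibilityAt_of_missingLowerBoundAt`
(`Typed.MissingLowerBoundAt W p` as hypothesis); x11a's p201894
(`X11a.mazurMainConjectureAt_of_padicValRat_le`) is LITERALLY the surjective `p ≥ 5` instance
(`hdiv` := Kato's divisibility `kato_charIdeal_dvd_multiplicative_of_surjective` at the pair, via
Serre's `surjective_pow_of_five_le`; the gate's dedup lint identifies the two statements, so the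
instance is not restated here). The REDUCIBLE instances (Wuthrich Thm. 16), the equivalences `MC ⟺ BSD(E,p) ⟺ lower
bound` on X2's rank-`0` half, the class-level exactness of X2b's typed input and the per-pair
main-conjecture certificates are in the companion `X2/RankZeroExact.lean`. What this does NOT do: no
class-level deletion (X2b's main conjecture — `μ > 0` allowed, `p ‖ N` — is in print for no class
of pairs; X2-GAP.md §3); nothing in rank `1`.

References: [GreenbergLNM1716] §4–5, Thm. 1.5, Prop. 5.7; [Wuthrich2014] Thm. 16, §5 (p. 397),
Prop. 21; [SteinWuthrich2013] Thm. 6.1, §4.2; [GreenbergStevens1993]; [MazurTateTeitelbaum1986]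
§I.14–15; [GreenbergVatsal2000] result B; [Skinner2016PacificMC] Thm. A (shape); [Miller2011LMS]
Def. 1.1.
-/

set_option autoImplicit false

noncomputable section

open scoped Classical MatrixGroups ModularForm

open CongruenceSubgroup WeierstrassCurve Literature.NumberTheory.EllipticCurves
  Literature.NumberTheory.EllipticCurves.ModularForms
  Literature.NumberTheory.EllipticCurves.Rank1Residual
  Literature.NumberTheory.EllipticCurves.Rank1Residual.Typed
  Literature.NumberTheory.EllipticCurves.Wuthrich2014
  Literature.NumberTheory.EllipticCurves.SteinWuthrich2013

namespace Summit.BirchSwinnertonDyer.Rank1Residual.X2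

/-! ### The core: one divisibility at the pair + the reverse inequality ⟹ Mazur's main conjecture -/

/-- **One divisibility + the reverse rank-`0` inequality ⟹ Mazur's main conjecture at an odd
multiplicative prime (core form, class-agnostic).** Data: `W/ℚ` globally minimal elliptic,
`p ≠ 2` of multiplicative reduction, `ord_{s=1}L(E,s) = 0`. Hypotheses: the PUBLISHED named facts
Stein–Wuthrich 2013 Thm. 6.1 (`hJs`, `hJn`) with the existence of THE §4.2 heights (`hHs`, `hHn`),
Greenberg–Stevens (`hGS`), Gross–Zagier–Kolyvagin (`hGZK`), modularity (`hmod`); an INLINE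
divisibility at the pair in Kato's shape (`hdiv`: for every datum `(κ, γ, f, ϖ, D)`, `X` is torsion
and `ι(g) = ϖ·L` (non-split) / `ι(T·g) = ϖ·L` (split) for some `g ∈ char_Λ X` — the per-pair
conclusion of `Wuthrich2014.thm16_charIdeal_dvd_multiplicative_of_reducible` (reducible `E[p]`) and
of `Wuthrich2014.kato_charIdeal_dvd_multiplicative_of_surjective` (surjective `ρ_{E,p^∞}`)); and the
REVERSE inequality `ord_p(L(E,1)/Ω_E) ≤ ord_p #Ш + ord_p ∏ c_v − 2 ord_p #E(ℚ)_tors` (`hlow`).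
Conclusion: `X2.MazurMainConjectureAt W p`. Proof (Greenberg LNM 1716 §4–5 made integral, x11a
gen 13's argument verbatim): `g = h · f_E`; `[T^e]`-coefficients (MTT / Greenberg–Stevens) against
Jones's leading term for the generator `f_E` (SW Thm. 6.1, `Reg_p = 1`) give
`(L(E,1)/Ω_E)·#tors² = h(0)·u·#Ш[p^∞]·∏c_v`; `hlow` forces `ord_p h(0) = 0`, so `h ∈ Λˣ`
(`PowerSeries.isUnit_iff_constantCoeff`). No hypothesis on `μ`, none on the image of `ρ̄_{E,p}`.
[cite: GreenbergLNM1716, §4 (PDF pp. 112–113) and §5 (closing examples)]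
[cite: SteinWuthrich2013, Thm. 6.1 (p. 20) and §4.2] [cite: GreenbergStevens1993, Thm. (trivial zero)]
[cite: MazurTateTeitelbaum1986, §I.14–I.15] -/
theorem mazurMainConjectureAt_of_divisibilityAt_of_padicValRat_le
    (hJs : thm61_splitMultiplicative) (hJn : thm61_nonsplitMultiplicative)
    (hHs : exists_isSplitMultCanonical) (hHn : exists_isMultCanonical)
    (hGZK : rank_eq_analyticRank_of_analyticRank_le_one) (hmod : hasEntireLFunction_rat)
    (W : WeierstrassCurve ℚ) [W.IsElliptic] [W.IsGloballyMinimal] (p : ℕ) [Fact p.Prime]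
    (hGS : greenberg_stevens (W := W) (p := p))
    (hp2 : p ≠ 2) (hmult : W.HasMultiplicativeReductionAtPrime p) (hr : W.analyticRank = 0)
    (hdiv : ∀ (κ : ZpExtension ℚ p) (γ : Field.absoluteGaloisGroup ℚ),
        κ.IsCyclotomic → κ.IsTopGenerator γ → IsCyclotomicVariable p γ →
      ∀ {N : ℕ} [NeZero N] (f : CuspForm (Gamma0 N) 2), IsNewformOf W f →
      ∀ (D : W.SelmerDualData κ γ) (ϖ : ℚ), (ϖ : ℝ) * W.realPeriodRat = plusPeriod f →
        D.IsTorsion ∧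
        (¬ W.HasSplitMultiplicativeReductionAtPrime p →
          ∀ L : PowerSeries ℚ_[p], IsMultPAdicLFunctionOf f p (-1) L →
            ∃ g ∈ D.charIdeal, iwasawaToPowerSeries p g = PowerSeries.C ((ϖ : ℚ) : ℚ_[p]) * L) ∧
        (W.HasSplitMultiplicativeReductionAtPrime p →
          ∀ L : PowerSeries ℚ_[p], IsSplitMultPAdicLFunctionOf f p L →
            ∃ g ∈ D.charIdeal, iwasawaToPowerSeries p (PowerSeries.X * g) =
              PowerSeries.C ((ϖ : ℚ) : ℚ_[p]) * L))
    (hlow : ∀ t : ℚ, W.entireLFunction 1 / (W.realPeriodRat : ℂ) = (t : ℂ) →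
      padicValRat p t ≤ (padicValNat p W.shaOrder : ℤ) + padicValNat p W.tamagawaProduct -
        2 * padicValNat p W.torsionOrder) :
    X2.MazurMainConjectureAt W p := by
  intro κ γ hκ hγ hγ' N _ f hf D ϖ hϖ
  have hpP : p.Prime := Fact.out
  haveI : Module.Finite (IwasawaAlgebra p) D.X := D.module_finite_holds hγ
  -- the divisibility at this datum
  obtain ⟨hX, hKns, hKs⟩ := hdiv κ γ hκ hγ hγ' f hf D ϖ hϖ
  -- a generator `fE` of the (principal) characteristic ideal
  haveI : (Literature.NumberTheory.EllipticCurves.Module.charIdeal (IwasawaAlgebra p) D.X).IsPrincipal :=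
    charIdeal_isPrincipal_holds p D.X
  obtain ⟨fE, hfE⟩ := Submodule.IsPrincipal.principal
    (Literature.NumberTheory.EllipticCurves.Module.charIdeal (IwasawaAlgebra p) D.X)
  have hchar : D.charIdeal = Ideal.span {fE} := hfE
  -- rank `0`: `L(E,1) ≠ 0`, `E(ℚ)` and `Ш` finite
  have hL1 : W.entireLFunction 1 ≠ 0 := (W.analyticRank_eq_zero_iff_holds (hmod W)).1 hr
  obtain ⟨hrank, hfin⟩ := hGZK W (by omega)
  have hr0 : W.mordellWeilRank = 0 := by rw [hrank, hr]
  haveI : Finite W.toAffine.Point := W.mordellWeilRank_eq_zero_iff_finite.mp hr0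
  haveI : Finite W.sha := hfin
  haveI : Finite (AddCommGroup.primaryComponent W.sha p) := inferInstance
  -- the rational `t = ϖ · [0]⁺_f = L(E,1)/Ω_E ≠ 0` and the reverse inequality at `t`
  have hΩpos : 0 < W.realPeriodRat := W.realPeriodRat_pos_holds
  have hϖ0 : ϖ ≠ 0 := by
    rintro rfl
    have hper : 0 < plusPeriod f := IsNewform0.plusPeriod_pos_holds hf.1 hf.coeffField_eq_bot
    rw [← hϖ, Rat.cast_zero, zero_mul] at hper
    exact lt_irrefl _ hper
  set s : ℚ := ratPlusSymbol f 0 with hs_def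
  set t : ℚ := ϖ * s with ht_def
  have hLval : W.entireLFunction 1 = (((s : ℝ) * plusPeriod f : ℝ) : ℂ) := hf.entireLFunction_one_eq
  have hq : W.entireLFunction 1 / (W.realPeriodRat : ℂ) = ((t : ℚ) : ℂ) := by
    rw [hLval, ← hϖ, div_eq_iff (Complex.ofReal_ne_zero.mpr hΩpos.ne'), ht_def]
    push_cast
    ring
  have hs0 : s ≠ 0 := by
    intro h0
    apply hL1
    rw [hLval, h0]
    simp
  have ht0 : t ≠ 0 := mul_ne_zero hϖ0 hs0
  have htcast : ((t : ℚ) : ℚ_[p]) = (ϖ : ℚ_[p]) * (s : ℚ_[p]) := by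
    rw [ht_def]; push_cast; ring
  have hle := hlow t hq
  -- how a cofactor `h` with the valuation identity becomes a unit
  have unit_of_key : ∀ (h : IwasawaAlgebra p) (u : ℤ_[p]ˣ),
      PowerSeries.constantCoeff h ≠ 0 →
      (t : ℚ_[p]) * (W.torsionOrder : ℚ_[p]) ^ 2 =
        ((PowerSeries.constantCoeff h : ℤ_[p]) : ℚ_[p]) * ((u : ℤ_[p]) : ℚ_[p]) *
          (Nat.card (AddCommGroup.primaryComponent W.sha p) : ℚ_[p]) * (W.tamagawaProduct : ℚ_[p]) →
      IsUnit h := by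
    intro h u hh00 key
    set h0 : ℚ_[p] := ((PowerSeries.constantCoeff h : ℤ_[p]) : ℚ_[p]) with hh0
    have hh0ne : h0 ≠ 0 := by
      rw [hh0]
      intro h0'
      exact hh00 (by exact_mod_cast (PadicInt.coe_eq_zero.mp h0'))
    have hh0val : 0 ≤ h0.valuation := by
      rw [hh0]
      exact PadicInt.valuation_coe_nonneg
    have hval := X11a.padicValRat_eq_of_torsionSq_mul_eq_cofactor W p ht0 h0 _ hh0ne
      (valuation_coe_units_eq_zero p u) (coe_units_ne_zero p u) key
    have hh0zero : h0.valuation = 0 := by linarith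
    have hvalh : (PowerSeries.constantCoeff h : ℤ_[p]).valuation = 0 := by
      have h' : (((PowerSeries.constantCoeff h : ℤ_[p]) : ℚ_[p])).valuation = 0 := by
        rw [← hh0]; exact hh0zero
      rw [PadicInt.valuation_coe] at h'
      exact_mod_cast h'
    have hunit0 : IsUnit (PowerSeries.constantCoeff h : ℤ_[p]) := by
      rw [PadicInt.isUnit_iff, PadicInt.norm_eq_zpow_neg_valuation hh00, hvalh]
      simp
    exact PowerSeries.isUnit_iff_constantCoeff.mpr hunit0
  refine ⟨hX, fE, hchar, fun hsplit L hL => ?_, fun hns L hL => ?_⟩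
  · /- SPLIT multiplicative `p`: `g = h · fE` with `ι(T · g) = ϖ · L`; compare
      `[T¹]`-coefficients (Greenberg–Stevens) with SW Thm. 6.1 (split, rank 0). -/
    obtain ⟨g, hgmem, hιg⟩ := hKs hsplit L hL
    have hgmem' : g ∈ Ideal.span {fE} := by rw [← hchar]; exact hgmem
    obtain ⟨h, hgh⟩ := Ideal.mem_span_singleton'.mp hgmem'
    -- data: Tate parameter, THE §4.2 height, `Reg_p = 1`, Schneider trivial
    obtain ⟨Dq⟩ := (nonempty_tateParameterData_iff_holds (W := W) (p := p)).mpr hsplit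
    obtain ⟨Dh, hDh⟩ := hHs W p hp2 Dq
    have hReg : padicRegulator Dh = 1 := padicRegulator_eq_one_of_finite W p Dh
    have hSch : SchneiderConjecture Dh := by
      rw [SchneiderConjecture, hReg]
      exact one_ne_zero
    -- SW Thm. 6.1 (split) for the generator `fE`
    obtain ⟨-, -, h3⟩ := hJs W p hp2 Dq κ γ hκ hγ hγ' D hX fE hchar Dh hDh
    obtain ⟨u, hu⟩ := h3 hSch inferInstance
    simp only [hr0, zero_add, pow_one, hReg, mul_one, PowerSeries.coeff_zero_eq_constantCoeff] at hu
    -- Greenberg–Stevens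
    obtain ⟨-, hGS1⟩ := hGS Dq hf hL
    have h𝓛0 : LInvariant Dq ≠ 0 := LInvariant_ne_zero_holds Dq
    -- `[T¹] ι(T · g) = g(0) = ϖ · [T¹] L`
    have h1 : ((PowerSeries.constantCoeff g : ℤ_[p]) : ℚ_[p]) =
        ((ϖ : ℚ) : ℚ_[p]) * PowerSeries.coeff 1 L := by
      have h := congrArg (PowerSeries.coeff 1) hιg
      rw [iwasawaToPowerSeries, PowerSeries.coeff_map, PowerSeries.coeff_succ_X_mul,
        PowerSeries.coeff_zero_eq_constantCoeff, PowerSeries.coeff_C_mul] at h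
      exact h
    -- `g(0) = h(0) · fE(0)`
    have hg0 : ((PowerSeries.constantCoeff g : ℤ_[p]) : ℚ_[p]) =
        ((PowerSeries.constantCoeff h : ℤ_[p]) : ℚ_[p]) *
          ((PowerSeries.constantCoeff fE : ℤ_[p]) : ℚ_[p]) := by
      rw [← hgh, map_mul]; push_cast; ring
    -- `g(0) ≠ 0` (since `[T¹]L · log = 𝓛 · s ≠ 0`), hence `h(0) ≠ 0`
    have hsQ0 : (s : ℚ_[p]) ≠ 0 := by exact_mod_cast hs0
    have hc1 : PowerSeries.coeff 1 L ≠ 0 := by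
      intro h0
      rw [h0, zero_mul] at hGS1
      exact (mul_ne_zero h𝓛0 hsQ0) hGS1.symm
    have hϖQ0 : ((ϖ : ℚ) : ℚ_[p]) ≠ 0 := by exact_mod_cast hϖ0
    have hh00 : PowerSeries.constantCoeff h ≠ 0 := by
      intro h0
      have : ((PowerSeries.constantCoeff g : ℤ_[p]) : ℚ_[p]) = 0 := by
        rw [hg0, h0, PadicInt.coe_zero, zero_mul]
      rw [h1] at this
      exact (mul_ne_zero hϖQ0 hc1) this
    -- the identity `t · #tors² = h(0) · u · #Ш[p^∞] · ∏ c_v` (cancel `𝓛_p`)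
    have key : (t : ℚ_[p]) * (W.torsionOrder : ℚ_[p]) ^ 2 =
        ((PowerSeries.constantCoeff h : ℤ_[p]) : ℚ_[p]) * ((u : ℤ_[p]) : ℚ_[p]) *
          (Nat.card (AddCommGroup.primaryComponent W.sha p) : ℚ_[p]) *
            (W.tamagawaProduct : ℚ_[p]) := by
      apply mul_left_cancel₀ h𝓛0
      rw [htcast]
      linear_combination (-(((ϖ : ℚ) : ℚ_[p]) * (W.torsionOrder : ℚ_[p]) ^ 2)) * hGS1 -
        (padicLog p (cyclotomicGenerator p) * (W.torsionOrder : ℚ_[p]) ^ 2) * h1 +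
        (padicLog p (cyclotomicGenerator p) * (W.torsionOrder : ℚ_[p]) ^ 2) * hg0 +
        ((PowerSeries.constantCoeff h : ℤ_[p]) : ℚ_[p]) * hu
    have hunit : IsUnit h := unit_of_key h u hh00 key
    refine ⟨hunit.unit, ?_⟩
    rw [IsUnit.unit_spec, show (PowerSeries.X : IwasawaAlgebra p) * fE * h = PowerSeries.X * g by
      rw [← hgh]; ring]
    exact hιg
  · /- NON-SPLIT multiplicative `p`: `g = h · fE` with `ι(g) = ϖ · L`; compare constant
      coefficients (`L(0) = 2[0]⁺_f`) with SW Thm. 6.1 (non-split, rank 0). -/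
    obtain ⟨g, hgmem, hιg⟩ := hKns hns L hL
    have hgmem' : g ∈ Ideal.span {fE} := by rw [← hchar]; exact hgmem
    obtain ⟨h, hgh⟩ := Ideal.mem_span_singleton'.mp hgmem'
    -- data: Tate parameter, THE §4.2 height, `Reg_p = 1`, Schneider trivial
    obtain ⟨q, ⟨hq0, hq1, hqj⟩, -⟩ := existsUnique_tateJ_eq_of_one_lt_norm
      (one_lt_norm_j_of_hasMultiplicativeReductionAtPrime (W := W) (p := p) hmult)
    obtain ⟨Dh, hDh⟩ := hHn W p hp2 hmult hns q hq0 hq1 hqj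
    have hReg : padicRegulator Dh = 1 := padicRegulator_eq_one_of_finite W p Dh
    have hSch : SchneiderConjecture Dh := by
      rw [SchneiderConjecture, hReg]
      exact one_ne_zero
    -- SW Thm. 6.1 (non-split) for the generator `fE`
    obtain ⟨-, -, h3⟩ := hJn W p hp2 hmult hns q hq0 hq1 hqj κ γ hκ hγ hγ' D hX fE hchar Dh hDh
    obtain ⟨u, hu⟩ := h3 hSch inferInstance
    simp only [hr0, pow_zero, mul_one, hReg, PowerSeries.coeff_zero_eq_constantCoeff] at hu
    -- constant coefficients: `g(0) = ϖ · L(0) = ϖ · 2 [0]⁺_f`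
    have hL0 : PowerSeries.constantCoeff L = 2 * (s : ℚ_[p]) := hL.constantCoeff_of_neg_one
    have h1 : ((PowerSeries.constantCoeff g : ℤ_[p]) : ℚ_[p]) =
        ((ϖ : ℚ) : ℚ_[p]) * (2 * (s : ℚ_[p])) := by
      have h := congrArg PowerSeries.constantCoeff hιg
      rw [constantCoeff_iwasawaToPowerSeries, map_mul, PowerSeries.constantCoeff_C, hL0] at h
      exact h
    -- `g(0) = h(0) · fE(0)`
    have hg0 : ((PowerSeries.constantCoeff g : ℤ_[p]) : ℚ_[p]) =
        ((PowerSeries.constantCoeff h : ℤ_[p]) : ℚ_[p]) *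
          ((PowerSeries.constantCoeff fE : ℤ_[p]) : ℚ_[p]) := by
      rw [← hgh, map_mul]; push_cast; ring
    have hsQ0 : (s : ℚ_[p]) ≠ 0 := by exact_mod_cast hs0
    have hϖQ0 : ((ϖ : ℚ) : ℚ_[p]) ≠ 0 := by exact_mod_cast hϖ0
    have hh00 : PowerSeries.constantCoeff h ≠ 0 := by
      intro h0
      have : ((PowerSeries.constantCoeff g : ℤ_[p]) : ℚ_[p]) = 0 := by
        rw [hg0, h0, PadicInt.coe_zero, zero_mul]
      rw [h1] at this
      exact (mul_ne_zero hϖQ0 (mul_ne_zero two_ne_zero hsQ0)) this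
    -- the identity `t · #tors² = h(0) · u · #Ш[p^∞] · ∏ c_v` (cancel `2`)
    have key : (t : ℚ_[p]) * (W.torsionOrder : ℚ_[p]) ^ 2 =
        ((PowerSeries.constantCoeff h : ℤ_[p]) : ℚ_[p]) * ((u : ℤ_[p]) : ℚ_[p]) *
          (Nat.card (AddCommGroup.primaryComponent W.sha p) : ℚ_[p]) *
            (W.tamagawaProduct : ℚ_[p]) := by
      apply mul_left_cancel₀ (two_ne_zero : (2 : ℚ_[p]) ≠ 0)
      rw [htcast]
      linear_combination (-((W.torsionOrder : ℚ_[p]) ^ 2)) * h1 +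
        ((W.torsionOrder : ℚ_[p]) ^ 2) * hg0 +
        ((PowerSeries.constantCoeff h : ℤ_[p]) : ℚ_[p]) * hu
    have hunit : IsUnit h := unit_of_key h u hh00 key
    refine ⟨hunit.unit, ?_⟩
    rw [IsUnit.unit_spec, show fE * h = g by rw [← hgh]; ring]
    exact hιg

/-- **The same with the cell's typed LOWER bound** `Typed.MissingLowerBoundAt W p`
(`ord_p #Ш(E/ℚ)_an ≤ ord_p #Ш(E/ℚ)`): `#Ш_an = (L(E,1)/Ω_E)·#E(ℚ)²/∏c_v`
(`Wuthrich2014.shaAn_eq_of_L_one_div_eq`) converts it to the reverse inequality of the core form.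
[cite: GreenbergLNM1716, §4 (PDF pp. 112–113) and §5 (closing examples)] [cite: Miller2011LMS, Def. 1.1] -/
theorem mazurMainConjectureAt_of_divisibilityAt_of_missingLowerBoundAt
    (hJs : thm61_splitMultiplicative) (hJn : thm61_nonsplitMultiplicative)
    (hHs : exists_isSplitMultCanonical) (hHn : exists_isMultCanonical)
    (hGZK : rank_eq_analyticRank_of_analyticRank_le_one) (hmod : hasEntireLFunction_rat)
    (W : WeierstrassCurve ℚ) [W.IsElliptic] [W.IsGloballyMinimal] (p : ℕ) [Fact p.Prime]
    (hGS : greenberg_stevens (W := W) (p := p))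
    (hp2 : p ≠ 2) (hmult : W.HasMultiplicativeReductionAtPrime p) (hr : W.analyticRank = 0)
    (hdiv : ∀ (κ : ZpExtension ℚ p) (γ : Field.absoluteGaloisGroup ℚ),
        κ.IsCyclotomic → κ.IsTopGenerator γ → IsCyclotomicVariable p γ →
      ∀ {N : ℕ} [NeZero N] (f : CuspForm (Gamma0 N) 2), IsNewformOf W f →
      ∀ (D : W.SelmerDualData κ γ) (ϖ : ℚ), (ϖ : ℝ) * W.realPeriodRat = plusPeriod f →
        D.IsTorsion ∧
        (¬ W.HasSplitMultiplicativeReductionAtPrime p →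
          ∀ L : PowerSeries ℚ_[p], IsMultPAdicLFunctionOf f p (-1) L →
            ∃ g ∈ D.charIdeal, iwasawaToPowerSeries p g = PowerSeries.C ((ϖ : ℚ) : ℚ_[p]) * L) ∧
        (W.HasSplitMultiplicativeReductionAtPrime p →
          ∀ L : PowerSeries ℚ_[p], IsSplitMultPAdicLFunctionOf f p L →
            ∃ g ∈ D.charIdeal, iwasawaToPowerSeries p (PowerSeries.X * g) =
              PowerSeries.C ((ϖ : ℚ) : ℚ_[p]) * L))
    (hlow : MissingLowerBoundAt W p) : X2.MazurMainConjectureAt W p := by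
  have hL : W.entireLFunction 1 ≠ 0 := (W.analyticRank_eq_zero_iff_holds (hmod W)).1 hr
  refine mazurMainConjectureAt_of_divisibilityAt_of_padicValRat_le hJs hJn hHs hHn hGZK hmod W p hGS
    hp2 hmult hr hdiv ?_
  intro q hq
  obtain ⟨-, hE, -, hshaAn⟩ := shaAn_eq_of_L_one_div_eq hGZK W hL hq
  haveI := hE
  obtain ⟨q', hq', hle'⟩ := hlow
  have hqq : q' = q * (Nat.card W.toAffine.Point : ℚ) ^ 2 / (W.tamagawaProduct : ℚ) := by
    exact_mod_cast hq'.symm.trans hshaAn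
  have hΩ : (W.realPeriodRat : ℂ) ≠ 0 := by exact_mod_cast W.realPeriodRat_pos_holds.ne'
  have hq0 : q ≠ 0 := by
    rintro rfl
    apply hL
    rw [Rat.cast_zero, div_eq_zero_iff] at hq
    exact hq.resolve_right hΩ
  have hcard : (Nat.card W.toAffine.Point : ℚ) ≠ 0 := by
    exact_mod_cast (Nat.card_pos (α := W.toAffine.Point)).ne'
  have htam : (W.tamagawaProduct : ℚ) ≠ 0 := by
    exact_mod_cast (W.tamagawaProduct_pos_holds : 0 < W.tamagawaProduct).ne'
  have hcardT : (Nat.card W.toAffine.Point : ℚ) = (W.torsionOrder : ℚ) := by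
    exact_mod_cast (W.torsionOrder_eq_natCard_of_finite).symm
  rw [hqq, padicValRat.div (mul_ne_zero hq0 (pow_ne_zero 2 hcard)) htam,
    padicValRat.mul hq0 (pow_ne_zero 2 hcard), padicValRat.pow, hcardT] at hle'
  simp only [padicValRat.of_nat, Nat.cast_ofNat] at hle'
  linarith

end Summit.BirchSwinnertonDyer.Rank1Residual.X2

end
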